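import Literature.AlgebraicGeometry.Resolution.HenselizedRationalImmediateExtProofs
import Literature.AlgebraicGeometry.Resolution.NormalDegreePDefectlessVTInseparable
import Literature.AlgebraicGeometry.Resolution.NormalDegreePDefectlessGalois
import Literature.AlgebraicGeometry.Resolution.HenselsLemmaProofs
import HarnessLib

/-!
# Galois extensions of degree `p` of `K(x)^h` with a value-transcendental generator: Cor. 4.2 from Props. 4.5–4.6 (Kuhlmann 2010, §4.1)

Topic: `Literature/AlgebraicGeometry/Resolution` (valued function fields). Second layer of the
decomposition below `Kuhlmann2010GaloisDegreePDefectlessVT` (`NormalDegreePDefectlessVT.lean`)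
= F.-V. Kuhlmann, *Elimination of ramification I: The generalized stability theorem*, Trans.
AMS 362 (2010) 5697–5727 = arXiv:1003.5678, **Cor. 4.2** in the value-transcendental case (4.2)
over an algebraically closed `K` — after `HenselizedRationalImmediateExtProofs.lean`,
`NormalDegreePDefectlessVTInseparable.lean` and `HenselsLemmaProofs.lean` the LAST named fact on
which the italicized statement of §5 for `K(x)^h` (`Kuhlmann2010HenselizedRationalImmediateExt`)
rests (`Kuhlmann2010HenselizedRationalImmediateExt.of_galoisDegreeP` below). The source derives
Cor. 4.2 from Prop. 4.1 ("Then either `(E|F,v)` is defectless or there is a Galois extension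
`L|K` of degree `p` with non-trivial defect such that `(L.E|L.F,v)` is defectless"; an
algebraically closed `K` has no Galois extension of degree `p` at all), and proves Prop. 4.1 in
the value-transcendental case (4.2) in §4.1 by two normal forms:

> **Proposition 4.5.** Let `K`, `F` and `E` be as in the value-transcendental case of
> Proposition 4.1, and assume that `char K = p`. Then either `E = F(ϑ)` where `ϑ^p − ϑ ∈ K`
> [(4.6)], or `E = F(ϑ)` where `ϑ^p − ϑ = c₀ + ∑_{i∈I} cᵢxⁱ`, `cᵢ ∈ K` with finite non-empty
> `I ⊂ ℤ ∖ pℤ` … If (4.6) does not hold, then `(vE:vF) = p` and the extension `(E|F,v)` is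
> defectless. If (4.6) holds then for `L = K(ϑ)` we have that the extension `(L.E|L.F,v)` is
> trivial and hence defectless.
>
> **Proposition 4.6.** Let `K`, `F` and `E` be as in the value-transcendental case of
> Proposition 4.1, and assume that `char K = 0`. Then `E = F(ϑ)` where `ϑ^p = x^m u`, … Further,
> `m ≠ 0` or `I ≠ ∅`. In both cases, `(vE:vF) = p`.

## Content

* NAMED FACTS, in the ambient specialisation of `NormalDegreePDefectlessVT.lean` (`(Ω, V)`
  algebraically closed with `char Ωv = p > 0`, `K ≤ Ω` an algebraically closed subfield, `x`
  value-transcendental over `K`, `F = K(x)^h = henselizedAdjoin V K x` of rank one, `F ≤ E`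
  Galois of degree `p`): `Kuhlmann2010Prop45ValueIndex` — Prop. 4.5 (`char K = p`): `(vE:vF) = p`
  or `E = F(ϑ)` with `ϑ^p − ϑ ∈ K`; `Kuhlmann2010Prop46ValueIndex` — Prop. 4.6 (`char K = 0`):
  `(vE:vF) = p`.
* `isDefectlessExtension_of_relIndex_valueSubgroup_eq` — `(vE : vF) = [E : F]` forces
  defectlessness (fundamental inequality). PROVED.
* `Kuhlmann2010GaloisDegreePDefectlessVT.of_props` — Cor. 4.2 (value-transcendental case) from
  the two named facts. PROVED: `char Ω` is `p` or `0`; in characteristic `p` the alternative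
  (4.6) of Prop. 4.5 would put `ϑ` in the algebraically closed `K ⊆ F`, making `E = F`.
* `Kuhlmann2010HenselizedRationalImmediateExt.of_galoisDegreeP`,
  `Kuhlmann2010HenselizedRationalImmediateExt.of_props` — the italicized statement of §5 for
  `K(x)^h` from Cor. 4.2 (value-transcendental case) alone, resp. from Props. 4.5–4.6, Hensel's
  Lemma (`Kuhlmann2010HenselsLemma_holds`) and the purely inseparable steps
  (`Kuhlmann2010PurelyInseparableDegreePDefectlessVT_holds`) being discharged. PROVED.

## Sources

* F.-V. Kuhlmann, *Elimination of ramification I: The generalized stability theorem*, Trans.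
  Amer. Math. Soc. 362 (2010) 5697–5727 = arXiv:1003.5678: §1 (1) (fundamental inequality),
  §4 ((4.1), (4.2), Prop. 4.1, Cor. 4.2), §4.1 (Lemma 4.4, Prop. 4.5, Prop. 4.6), §5 (p. 19).

## Rendering notes

* Props. 4.5 and 4.6 are printed under (4.1) ("`(K,v)` is henselian and `p = char K̄ > 0`, and
  `K` is closed under `p`-th roots") for `F` of the form (4.2); here `K` is an algebraically
  closed subfield of `Ω` (henselian, perfect, closed under `p`-th roots, `char K̄ = char Ωv = p`)
  — the specialisation in which Cor. 4.2 is consumed on pp. 19–20 —, and only the conclusions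
  used by Cor. 4.2 are vendored: the value index `(vE:vF) = p` (both propositions) and, for
  Prop. 4.5, the alternative (4.6) `E = F(ϑ)`, `ϑ^p − ϑ ∈ K` (which cannot occur over an
  algebraically closed `K`, but is part of the printed statement). The normal forms themselves
  (the finite Laurent series `c₀ + ∑ cᵢxⁱ`, the `1`-unit `u`) are not vendored.
* `(vE:vF)` is the relative index of the value subgroups `vF ≤ vE ≤ |Ω^×|`
  (`valueSubgroup`, `DefectAmbient.lean`), i.e. `e` of `V ∩ E` over `F`, the unique extension
  of the valuation of the henselian `F = K(x)^h`.
* What is NOT here: the proofs of Props. 4.5–4.6 (Lemma 2.4: a rank-one field is dense in its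
  henselization; Lemma 4.4: `K[x,x⁻¹]` is dense in `K(x)^h`, `F = R + ℘(F)`; Artin–Schreier
  theory — PROVED in `Literature/FieldTheory/ArtinSchreier/` —; Kummer theory, Lemmas 2.9–2.10,
  Cor. 2.11 and the elimination of `p`-th powers of §4.1).
-/

noncomputable section

open IsLocalRing

namespace Literature.AlgebraicGeometry.Resolution

universe u

/-! ### Props. 4.5 and 4.6 as named facts -/

/-- NAMED FACT — **Kuhlmann 2010, Prop. 4.5 (equal characteristic, value-transcendental case),
value index.** "Let `K`, `F` and `E` be as in the value-transcendental case of Proposition 4.1,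
and assume that `char K = p`. Then either `E = F(ϑ)` where `ϑ^p − ϑ ∈ K` [(4.6)], or
`E = F(ϑ)` where `ϑ^p − ϑ = c₀ + ∑_{i∈I} cᵢxⁱ`, `cᵢ ∈ K` with finite non-empty `I ⊂ ℤ ∖ pℤ` and
such that `∀ i ∈ I: vcᵢxⁱ < 0` and `∀ i ∈ I: vcᵢxⁱ < vc₀ ≤ 0` if `c₀ ≠ 0`. If (4.6) does not hold,
then `(vE:vF) = p` and the extension `(E|F,v)` is defectless." Here "as in Proposition 4.1"
means: `(K,v)` satisfies (4.1) ("henselian and `p = char K̄ > 0`, and `K` is closed under `p`-th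
roots"), `F = K(x)^h` is of rank 1 with `x` value-transcendental over `K` ((4.2)), and `(E|F,v)`
is a Galois extension of degree `p`. Rendering (the specialisation used by Cor. 4.2 on
pp. 19–20): `(Ω, V)` algebraically closed with `char Ω = p = char Ωv`, `K ≤ Ω` an algebraically
closed subfield, `x` value-transcendental over `K`, `F = henselizedAdjoin V K x` of rank one,
`F ≤ E` Galois of degree `p` (`IsGaloisStep`); then `(vE : vF) = p` (relative index of the value
subgroups) or `E = F(ϑ)` for some `ϑ ∈ E` with `ϑ^p − ϑ ∈ K`. Its proof (Artin–Schreier theory,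
Lemma 4.4 — `K[x,x⁻¹]` is dense in `K(x)^h` by Lemma 2.4 —, `𝓜_F ⊆ ℘(F)` by Hensel's Lemma, and
the reduction of the Laurent series) is §4.1 of the source, not in Mathlib. Users take
`(h : Kuhlmann2010Prop45ValueIndex)`. [cite: Kuhlmann2010, Prop. 4.5] -/
def Kuhlmann2010Prop45ValueIndex : Prop :=
  ∀ (Ω : Type u) [Field Ω] [IsAlgClosed Ω] (V : ValuationSubring Ω) (p : ℕ)
    [CharP (ResidueField V) p] [CharP Ω p],
    p.Prime → ∀ (K : Subfield Ω), IsAlgClosed K → ∀ x : Ω, IsValueTranscendentalOver V K x →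
    IsRankOneValued V (henselizedAdjoin V K x) →
    ∀ E : Subfield Ω, IsGaloisStep p (henselizedAdjoin V K x) E →
      (valueSubgroup (henselizedAdjoin V K x) V).relIndex (valueSubgroup E V) = p ∨
        ∃ ϑ ∈ E, ϑ ^ p - ϑ ∈ K ∧
          E = (IntermediateField.adjoin (henselizedAdjoin V K x) ({ϑ} : Set Ω)).toSubfield

/-- NAMED FACT — **Kuhlmann 2010, Prop. 4.6 (mixed characteristic, value-transcendental case),
value index.** "Let `K`, `F` and `E` be as in the value-transcendental case of Proposition 4.1,
and assume that `char K = 0`. Then `E = F(ϑ)` where `ϑ^p = x^m u`, with `m ∈ {0,…,p−1}` and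
`u ∈ K[x,x⁻¹]` a `1`-unit of the form `u = 1 + ∑_{i∈I} cᵢxⁱ`, `cᵢ ∈ K`, with finite index set
`I ⊂ ℤ ∖ {0}` and `∀ i ∈ I: 0 < vcᵢxⁱ ≤ (p/(p−1))vp` and (`i ∈ pℤ ⇒ vcᵢxⁱ > vp`). … Further,
`m ≠ 0` or `I ≠ ∅`. In both cases, `(vE:vF) = p`." Only the last assertion is vendored, in the
specialisation of `Kuhlmann2010Prop45ValueIndex` with `char Ω = 0`: then `(vE : vF) = p`. Its
proof (Kummer theory, Lemmas 2.9–2.10, Cor. 2.11, Lemma 4.4 and the elimination of `p`-th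
powers) is §4.1 of the source, not in Mathlib. Users take `(h : Kuhlmann2010Prop46ValueIndex)`.
[cite: Kuhlmann2010, Prop. 4.6 (last assertion)] -/
def Kuhlmann2010Prop46ValueIndex : Prop :=
  ∀ (Ω : Type u) [Field Ω] [IsAlgClosed Ω] [CharZero Ω] (V : ValuationSubring Ω) (p : ℕ)
    [CharP (ResidueField V) p],
    p.Prime → ∀ (K : Subfield Ω), IsAlgClosed K → ∀ x : Ω, IsValueTranscendentalOver V K x →
    IsRankOneValued V (henselizedAdjoin V K x) →
    ∀ E : Subfield Ω, IsGaloisStep p (henselizedAdjoin V K x) E →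
      (valueSubgroup (henselizedAdjoin V K x) V).relIndex (valueSubgroup E V) = p

/-! ### Lemmas for the assembly -/

section Lemmas

variable {Ω : Type u} [Field Ω] {V : ValuationSubring Ω}

/-- **`(vE : vF) = [E : F]` forces defectlessness**: by the fundamental inequality
`(vE : vF)·[Ev : Fv] ≤ [E : F]` with `[Ev : Fv] ≥ 1`, `(vE : vF) = [E : F]` gives `[Ev : Fv] = 1`
and `[E : F] = (vE : vF)·[Ev : Fv]` ("If `[L:K] = p` then `(L|K,v)` has non-trivial defect if and
only if it is immediate"). [cite: Kuhlmann2010, Section 1, (1) and Section 2.3] -/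
theorem isDefectlessExtension_of_relIndex_valueSubgroup_eq {F E : Subfield Ω} (hle : F ≤ E)
    (hpos : 0 < Subfield.relfinrank F E)
    (he : (valueSubgroup F V).relIndex (valueSubgroup E V) = Subfield.relfinrank F E) :
    IsDefectlessExtension V F E := by
  obtain ⟨-, hf, hef⟩ := relIndex_mul_relfinrank_le_relfinrank V hle hpos
  rw [he] at hef
  have hf1 : (residueSubfield F V).relfinrank (residueSubfield E V) = 1 := by
    have h1 : Subfield.relfinrank F E * (residueSubfield F V).relfinrank (residueSubfield E V) ≤
        Subfield.relfinrank F E * 1 := by rw [mul_one]; exact hef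
    exact le_antisymm (Nat.le_of_mul_le_mul_left h1 hpos) hf
  refine ⟨hle, hpos, ?_⟩
  rw [he, hf1, mul_one]

/-- **The alternative (4.6) of Prop. 4.5 does not occur over an algebraically closed `K`**: if
`E = F(ϑ)` with `ϑ^p − ϑ ∈ K` and `K ≤ F`, then `ϑ ∈ K` (it is a root of `X^p − X − c`, `c ∈ K`)
and `E = F`, so `E|F` is not a Galois step of degree `p ≠ 1`. [folklore] -/
theorem not_isGaloisStep_of_pow_sub_self_mem {p : ℕ} (hp : p.Prime) {K F E : Subfield Ω}
    (hK : IsAlgClosed K) (hKF : K ≤ F) {ϑ : Ω} (hϑ : ϑ ^ p - ϑ ∈ K)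
    (hE : E = (IntermediateField.adjoin F ({ϑ} : Set Ω)).toSubfield) (h : IsGaloisStep p F E) :
    False := by
  -- `ϑ` is algebraic over `K`, hence in `K`
  have hϑK : ϑ ∈ K := by
    refine mem_of_isAlgebraic_of_isAlgClosed hK ⟨Polynomial.X ^ p - Polynomial.X -
      Polynomial.C (⟨ϑ ^ p - ϑ, hϑ⟩ : K), ?_, ?_⟩
    · intro h0
      have h1 := congrArg (Polynomial.coeff · p) h0
      simp only [Polynomial.coeff_sub, Polynomial.coeff_X_pow, if_true, Polynomial.coeff_X,
        Polynomial.coeff_C, Polynomial.coeff_zero] at h1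
      rw [if_neg hp.one_lt.ne, if_neg hp.ne_zero] at h1
      simp at h1
    · simp only [map_sub, map_pow, Polynomial.aeval_X, Polynomial.aeval_C]
      exact sub_self _
  -- hence `E = F`
  have hEF : E = F := by
    rw [hE]
    refine le_antisymm ?_ (subfield_le_toSubfield _)
    have : IntermediateField.adjoin F ({ϑ} : Set Ω) = ⊥ :=
      IntermediateField.adjoin_simple_eq_bot_iff.mpr ⟨⟨ϑ, hKF hϑK⟩, rfl⟩
    rw [this, bot_toSubfield]
  subst hEF
  obtain ⟨hle, hdeg, -⟩ := h
  have h1 : Subfield.relfinrank E E = p := by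
    rw [Subfield.relfinrank_eq_finrank_of_le hle, hdeg]
  rw [Subfield.relfinrank_self] at h1
  exact hp.one_lt.ne h1

end Lemmas

/-! ### Assembly: Cor. 4.2 (value-transcendental case) from Props. 4.5–4.6 -/

/-- **Kuhlmann 2010, Cor. 4.2 (value-transcendental case over an algebraically closed `K`) from
Prop. 4.5 and Prop. 4.6.** PROVED: `char Ω` is `p` or `0`
(`charP_or_charZero_of_residueField`). If `char Ω = p`, Prop. 4.5
(`Kuhlmann2010Prop45ValueIndex`) gives `(vE:vF) = p = [E : F]` — hence defectlessness by the
fundamental inequality (`isDefectlessExtension_of_relIndex_valueSubgroup_eq`) — or the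
alternative (4.6), impossible over the algebraically closed `K`
(`not_isGaloisStep_of_pow_sub_self_mem`). If `char Ω = 0`, Prop. 4.6
(`Kuhlmann2010Prop46ValueIndex`) gives `(vE:vF) = p`. [cite: Kuhlmann2010, Cor. 4.2 (with Prop. 4.1, Props. 4.5–4.6)] -/
theorem Kuhlmann2010GaloisDegreePDefectlessVT.of_props (h45 : Kuhlmann2010Prop45ValueIndex.{u})
    (h46 : Kuhlmann2010Prop46ValueIndex.{u}) : Kuhlmann2010GaloisDegreePDefectlessVT.{u} := by
  intro Ω _ _ V p _ hp K hK x hx hr E hstep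
  have hle : henselizedAdjoin V K x ≤ E := hstep.le
  have hrel : Subfield.relfinrank (henselizedAdjoin V K x) E = p := hstep.isNormalStep.relfinrank_eq
  have hpos : 0 < Subfield.relfinrank (henselizedAdjoin V K x) E := by
    rw [hrel]
    exact hp.pos
  rcases charP_or_charZero_of_residueField V hp with hcharp | hchar0
  · haveI := hcharp
    rcases h45 Ω V p hp K hK x hx hr E hstep with he | ⟨ϑ, -, hϑ, hE⟩
    · exact isDefectlessExtension_of_relIndex_valueSubgroup_eq hle hpos (he.trans hrel.symm)
    · exact absurd hstep
        (fun h => not_isGaloisStep_of_pow_sub_self_mem hp hK (le_henselizedAdjoin V K x) hϑ hE h)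
  · haveI := hchar0
    have he := h46 Ω V p hp K hK x hx hr E hstep
    exact isDefectlessExtension_of_relIndex_valueSubgroup_eq hle hpos (he.trans hrel.symm)

/-! ### The italicized statement of §5 for `K(x)^h`: trust base -/

/-- **The italicized statement of §5 for `K(x)^h` from Cor. 4.2 (value-transcendental case)
alone**: Hensel's Lemma for henselian fields (`Kuhlmann2010HenselsLemma_holds`,
`HenselsLemmaProofs.lean`) and the purely inseparable steps
(`Kuhlmann2010PurelyInseparableDegreePDefectlessVT_holds`, `NormalDegreePDefectlessVTInseparable.lean`)
being discharged, `Kuhlmann2010HenselizedRationalImmediateExt` rests on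
`Kuhlmann2010GaloisDegreePDefectlessVT` only. PROVED.
[cite: Kuhlmann2010, Section 5, proof of Thm. 1.1 (p. 19)] -/
theorem Kuhlmann2010HenselizedRationalImmediateExt.of_galoisDegreeP
    (hG : Kuhlmann2010GaloisDegreePDefectlessVT.{u}) :
    Kuhlmann2010HenselizedRationalImmediateExt.{u} :=
  Kuhlmann2010HenselizedRationalImmediateExt.of_parts Kuhlmann2010HenselsLemma_holds hG
    Kuhlmann2010PurelyInseparableDegreePDefectlessVT_holds

/-- **The italicized statement of §5 for `K(x)^h` from Props. 4.5–4.6** (everything else being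
proved). PROVED. [cite: Kuhlmann2010, Section 5, proof of Thm. 1.1 (p. 19), with Props. 4.5–4.6] -/
theorem Kuhlmann2010HenselizedRationalImmediateExt.of_props (h45 : Kuhlmann2010Prop45ValueIndex.{u})
    (h46 : Kuhlmann2010Prop46ValueIndex.{u}) : Kuhlmann2010HenselizedRationalImmediateExt.{u} :=
  Kuhlmann2010HenselizedRationalImmediateExt.of_galoisDegreeP
    (Kuhlmann2010GaloisDegreePDefectlessVT.of_props h45 h46)

end Literature.AlgebraicGeometry.Resolution
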